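import Summits.AtomisticToContinuum.Crystallization.Theorems.ChargedEnergyGapStabilityReduction
import HarnessLib

/-!
(SPLIT FOR THE 400-LINE CAP by the landing lane, hand-2 g31: this file = part 1 of 4; sequels `…ChargedEnergyGapStabilityNumericsB`, `…ChargedEnergyGapStabilityNumericsC`, `…ChargedEnergyGapStabilityNumerics` import it in a chain; same namespace, all FQNs unchanged.)
# `ChargedEnergyGap` — the ROTATION GAUGE, addendum P-L: STAB-61 IN THE KERNEL — the two scalar lattice-sum inequalities PROVED, hence
# `HarmStableModRot (1/100) (fccRef a₀)` and the COMPLETE hypothesis block of (H𝄪ʳ) at the record dials WITNESSED (cell `decomp-a2c`, lens 3,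
# generation 61, node «RotationGauge», part P-L; over part P-K `…Theorems.ChargedEnergyGapStabilityReduction`)

WHAT THIS PART PROVES (every theorem PROVED, no `sorry`; axioms of the ★★★ theorems exactly `[propext, Classical.choice, Quot.sound]` —
the kernel evaluations use `decide` WITHOUT `native_decide`/`ofReduceBool`).  P-K reduced census ask STAB-61 to the pair of scalar inequalities
`4·(1/100)·N₂(a₀) ≤ P₄(a₀) − P₂₂(a₀)` and `4·(1/100)·N₂(a₀) ≤ 2P₂₂(a₀)` between explicit lattice sums over `D₃ ∖ 0` at the stress-free cubic
parameter `a₀` (`a₀⁶ = Z(12)/Z(6)`).  This part PROVES them: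
  ★★★ `dev_ineq   : 0 < b → b⁶ = Z(12)/Z(6) → 4·(1/100)·N₂(b) ≤ P₄(b) − P₂₂(b)`,
  ★★★ `shear_ineq : 0 < b → b⁶ = Z(12)/Z(6) → 4·(1/100)·N₂(b) ≤ 2·P₂₂(b)`,
  ★★★ `stab61 : 4·(1/100)·N₂(a₀) ≤ P₄(a₀) − P₂₂(a₀) ∧ 4·(1/100)·N₂(a₀) ≤ 2P₂₂(a₀)`,
  ★★★ `stabIneq_record : StabIneq (1/100) a₀`,  ★★★ `harmStableModRot_fcc_a0_record : HarmStableModRot (1/100) (fccRef a₀)`,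
  ★★★ `exists_admissible_harmStableModRot : ∃ P, IsSeparatedRef (3/5) P ∧ IsLabelledRef (1/3) 3 P ∧ IsForceFree P ∧ IsStressFree P ∧
       HarmStableModRot (1/100) P` — the COMPLETE hypothesis block of the repaired transfer piece (H𝄪ʳ) at the record dials
       `s = 3/5, lam = 1/3, ℓ = 3, μ₀ = 1/100`, UNCONDITIONALLY.
By-products (Epstein zeta values of `D₃` and the stress-free window, all PROVED): ★ `Z6_ge/Z6_le : 1.79334 ≤ Z_{D₃}(6) ≤ 1.92876`,
★ `Z12_ge/Z12_le : 0.1895603 ≤ Z_{D₃}(12) ≤ 0.1895691`, ★ `a0_pow_six_window : 491/5000 ≤ a₀⁶ ≤ 529/5000`, ★ `a0_sq_window : 2/5 < a₀² ≤ 473/1000`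
(P-J had only `9/50 ≤ a₀² ≤ 1`), ★ `N2_le : b² > 2/5 → N₂(b) ≤ 96b²`.

THE METHOD (§L1–§L7; the device is ONE bridge lemma + SEVEN kernel evaluations, everything else is linear bookkeeping).
 (L1–L2) SYMMETRISED CLOSED FORMS.  With `s₄(n) = Σ nₖ⁴`, `s₂₂(n) = Σ_{k<l} nₖ²nₗ²` and `coef b n = 14|bn|⁻¹⁶ − 8|bn|⁻¹⁰`
      (`coef_eq : coef b n = 14 b⁻¹⁶|n|⁻¹⁶ − 8 b⁻¹⁰|n|⁻¹⁰`), P-K's swap covariance gives for free ★ `three_mul_P4 : 3P₄ = Σ' coef·b⁴·s₄` and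
      ★ `three_mul_P22 : 3P₂₂ = Σ' coef·b⁴·s₂₂`, so `P₄ − P₂₂ = Σ' f_dev`, `2P₂₂ = Σ' f_sh` with summands controlled by `0 ≤ s₄ − s₂₂ ≤ |n|⁴`,
      `0 ≤ 3s₂₂ ≤ |n|⁴` (the symmetrisation is what makes the cube `K = 4` suffice: it divides the tail constants by `3` and `9/2`).
 (L3) CUBE SHELLS ★ `abs_tsum_sub_sum_cubeD_le : Summable f → (∀ n ∉ [−K,K]³, |f n| ≤ c|n|⁻⁶) → |Σ' f − Σ_{n ∈ [−K,K]³} f| ≤ 26c/(3K³)`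
      (`K ≥ 1`): the layer `|n|_∞ = M+1` has `24(M+1)² + 2` points (`card_layer`) each with `|n|⁻⁶ ≤ (M+1)⁻⁶`, and
      `26(M+1)⁻⁴ ≤ 26(1/(3M³) − 1/(3(M+1)³))` (`layer_step`, an exact polynomial identity) telescopes (`sum_sdiff_cube_le`).
 (L4) THE BRIDGE ★ `sum_cubeD_eq_boxQ : (∀ i j k, Φ(i,j,k) = φ i j k) → Σ_{n ∈ [−K,K]³ ∩ D₃∖0} Φ n = (boxQ φ K : ℚ)` where
      `boxQ φ K = Σ_{i,j,k < 2K+1} [d3test] φ(i−K, j−K, k−K)` is a COMPUTABLE rational triple sum (`cube_eq_image`, `Finset.sum_image`,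
      `d3test_iff`), and ★ THE SEVEN EXACT VALUES at `K = 4` (364 lattice vectors each) by `decide` — kernel evaluation of closed rational terms:
      `boxQ qZ6 4 = Σ|n|⁻⁶ = 2198966700904015800257/1226182819605359616000 ≈ 1.79334`, `boxQ qZ12 4 ≈ 0.18956040`,
      `boxQ qX8 4 = Σ(s₄−s₂₂)|n|⁻¹⁶ ≈ 0.04850022`, `boxQ qX5 4 = Σ(s₄−s₂₂)|n|⁻¹⁰ ≈ 0.5320852`, `boxQ qY8 4 = Σ s₂₂|n|⁻¹⁶ ≈ 0.04702006`,
      `boxQ qY5 4 = Σ s₂₂|n|⁻¹⁰ ≈ 0.4204194`, `boxQ qN2 4 = Σ_{|n|² ≤ 9} n₀² = 96` (`cube_Z6`, …, `cube_N2` are the real-number forms).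
 (L5) ★ `N2_le`: for `b² > 2/5` every neighbour `x ∈ nbhd b` has `|x|² < 10`, i.e. `≤ 9` by integrality, so `N₂(b) = b²Σ_{nbhd} x₀² ≤ 96 b²`.
 (L6) THE WINDOW: `Z(6) ∈ [cube, cube + 13/96]`, `Z(12) ∈ [cube, cube + 13/(96·15625)]` (off the cube `|n|⁻⁶ ≤ 1/15625`), hence
      ★ `le_pow_six/pow_six_le : 491/5000 ≤ b⁶ ≤ 529/5000`, ★ `two_fifths_lt_sq`, `sq_le_T : 2/5 < b² ≤ 473/1000` for `b⁶ = Z(12)/Z(6)`.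
 (L7) TAILS AND ASSEMBLY: off the cube `|f_dev| ≤ c_dev|n|⁻⁶`, `|f_sh| ≤ c_sh|n|⁻⁶` with `c_dev = (14b⁻¹²/15625 + 8b⁻⁶)/3`, `c_sh = (2/3)c_dev`
      (`abs_fdev_le`, `abs_fsh_le`, from `abs_coef_le'` and `weight_bound`); the cube parts in closed form (`sum_cube_fdev`, `sum_cube_fsh`);
      so `P₄ − P₂₂ ≥ (14b⁻¹²X₈ − 8b⁻⁶X₅)/3 − 26c_dev/192` (`P4_sub_P22_ge`) and `2P₂₂ ≥ …` (`two_P22_ge`).  After multiplying by `3b¹²`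
      (resp. `3b¹²/2`) the claim is LINEAR in the atoms `u = b⁶ ≤ 529/5000`, `u²b² ≤ (529/5000)²·(473/1000)`:
      DEV  `11.52 u²b² + 8u·X₅ + (13/96)(14/15625 + 8u) ≤ 14·X₈`   (worst case `0.626 ≤ 0.679`),
      SHEAR `5.76 u²b² + 8u·Y₅ + (13/288)(14/15625 + 8u) ≤ 14·Y₈` (worst case `0.425 ≤ 0.658`) — closed by `nlinarith`/`linarith` (`dev_ineq`,
      `shear_ineq`, via the exact identities `key`).  The margins match the floating-point values of P-K (softest mode deviatoric `≈ 0.037 > 1/100`).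

WHAT IT MEANS FOR THE NODE.  Critic row 1109 (K-v) asked for an admissible reference instance CARRYING the repaired (rotation-gauged) stability
hypothesis; P-J built the instance (fcc at `a₀`), P-K reduced `HarmStableModRot (1/100)` on it to two scalar inequalities, and P-L proves them:
the tag on (H𝄪ʳ) moves from [hyps-witnessed-modulo-`StabIneq (1/100) a₀`] to [HYPS-WITNESSED] — census ask STAB-61 is CLOSED in the kernel at the
record dials.  The instrument is reusable: any lattice functional with rational values on `ℤ³` and an `|n|⁻⁶` tail is now a `decide` away
(`sum_cubeD_eq_boxQ` + `abs_tsum_sub_sum_cubeD_le`), which is the typed road for the multi-site (`RelaxedBarlowRef σ`) versions of STAB in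
generation 62.

Consumption status: consumer-only (nothing here is consumed by `closes`); P-L completes the hypothesis audit of (H𝄪ʳ): its full hypothesis
block is instantiated by an explicit admissible force-free, stress-free periodic reference.
-/

noncomputable section

open scoped Classical
open Literature.MathematicalPhysics.StatisticalMechanics
open Literature.Geometry.DiscreteGeometry
open Summit.AtomisticToContinuum.Crystallization.Theses.PricedLinkCensus
open Summit.AtomisticToContinuum.Crystallization.Theorems.ChargedEnergyGapNegative

namespace Summit.AtomisticToContinuum.Crystallization.Theorems.ChargedEnergyGapChartDial

namespace Fcc

/-! ## §L1–§L3 Symmetrised closed forms of `P₄ − P₂₂` and `2P₂₂`; cubes, layers and the tail estimate -/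

section Numerics

variable {b : ℝ}

/-! ### L1. Arithmetic of the weights and the moment polynomials -/

/-- `len_sq'` (docstring added by the landing lane; see the module docstring). [formal bookkeeping] -/
theorem len_sq' (a : ℝ) (n : D3) : len a n ^ 2 = a ^ 2 * nsq n.1 := by
  rw [len, mul_pow, Real.sq_sqrt (nsq_nonneg _)]

/-- `inv_len_sq` (docstring added by the landing lane; see the module docstring). [formal bookkeeping] -/
theorem inv_len_sq (a : ℝ) (n : D3) : (len a n)⁻¹ ^ 2 = (a⁻¹) ^ 2 * (nsq n.1)⁻¹ := by
  rw [inv_pow, inv_pow, len_sq', mul_inv]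

/-- `inv_len_pow_even` (docstring added by the landing lane; see the module docstring). [formal bookkeeping] -/
theorem inv_len_pow_even (a : ℝ) (n : D3) (m : ℕ) :
    ((len a n)⁻¹) ^ (2 * m) = (a⁻¹) ^ (2 * m) * ((nsq n.1)⁻¹) ^ m := by
  calc ((len a n)⁻¹) ^ (2 * m) = (((len a n)⁻¹) ^ 2) ^ m := pow_mul _ _ _
    _ = ((a⁻¹) ^ 2 * (nsq n.1)⁻¹) ^ m := by rw [inv_len_sq]
    _ = (a⁻¹) ^ (2 * m) * ((nsq n.1)⁻¹) ^ m := by rw [mul_pow, ← pow_mul]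

/-- The stiffness weight as a rational function of `|n|²`: `coef b n = 14 b⁻¹⁶ |n|⁻¹⁶ − 8 b⁻¹⁰ |n|⁻¹⁰`. -/
theorem coef_eq (b : ℝ) (n : D3) :
    coef b n = 14 * (b⁻¹) ^ 16 * ((nsq n.1)⁻¹) ^ 8 - 8 * (b⁻¹) ^ 10 * ((nsq n.1)⁻¹) ^ 5 := by
  rw [coef, show (16 : ℕ) = 2 * 8 by norm_num, show (10 : ℕ) = 2 * 5 by norm_num, inv_len_pow_even b n 8,
    inv_len_pow_even b n 5]
  ring

/-- `s₄(x) = Σ xᵢ⁴` and `s₂₂(x) = x₀²x₁² + x₀²x₂² + x₁²x₂²`. -/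
def s4 (x : Fin 3 → ℤ) : ℝ := ((x 0 : ℝ)) ^ 4 + ((x 1 : ℝ)) ^ 4 + ((x 2 : ℝ)) ^ 4

/-- `s22` (docstring added by the landing lane; see the module docstring). [formal bookkeeping] -/
def s22 (x : Fin 3 → ℤ) : ℝ :=
  ((x 0 : ℝ)) ^ 2 * ((x 1 : ℝ)) ^ 2 + ((x 0 : ℝ)) ^ 2 * ((x 2 : ℝ)) ^ 2 + ((x 1 : ℝ)) ^ 2 * ((x 2 : ℝ)) ^ 2

/-- `nsq_eq_three` (docstring added by the landing lane; see the module docstring). [formal bookkeeping] -/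
theorem nsq_eq_three (x : Fin 3 → ℤ) : nsq x = ((x 0 : ℝ)) ^ 2 + ((x 1 : ℝ)) ^ 2 + ((x 2 : ℝ)) ^ 2 := by
  simp [nsq, Fin.sum_univ_three]

/-- `nsq_sq_eq` (docstring added by the landing lane; see the module docstring). [formal bookkeeping] -/
theorem nsq_sq_eq (x : Fin 3 → ℤ) : nsq x ^ 2 = s4 x + 2 * s22 x := by
  rw [nsq_eq_three]; unfold s4 s22; ring

/-- `s₄ − s₂₂ = ½ Σ_{i<j} (xᵢ² − xⱼ²)² ≥ 0`. -/
theorem s22_le_s4 (x : Fin 3 → ℤ) : s22 x ≤ s4 x := by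
  unfold s22 s4
  nlinarith [sq_nonneg (((x 0 : ℝ)) ^ 2 - ((x 1 : ℝ)) ^ 2), sq_nonneg (((x 0 : ℝ)) ^ 2 - ((x 2 : ℝ)) ^ 2),
    sq_nonneg (((x 1 : ℝ)) ^ 2 - ((x 2 : ℝ)) ^ 2)]

/-- `s22_nonneg` (docstring added by the landing lane; see the module docstring). [formal bookkeeping] -/
theorem s22_nonneg (x : Fin 3 → ℤ) : 0 ≤ s22 x := by unfold s22; positivity

/-- `s4_sub_s22_le` (docstring added by the landing lane; see the module docstring). [formal bookkeeping] -/
theorem s4_sub_s22_le (x : Fin 3 → ℤ) : s4 x - s22 x ≤ nsq x ^ 2 := by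
  rw [nsq_sq_eq]; linarith [s22_nonneg x]

/-- `three_mul_s22_le` (docstring added by the landing lane; see the module docstring). [formal bookkeeping] -/
theorem three_mul_s22_le (x : Fin 3 → ℤ) : 3 * s22 x ≤ nsq x ^ 2 := by
  rw [nsq_sq_eq]; linarith [s22_le_s4 x]

/-! ### L2. Symmetrised closed forms: `3P₄ = Σ' coef·b⁴·s₄`, `3P₂₂ = Σ' coef·b⁴·s₂₂` -/

/-- `three_mul_P4` (docstring added by the landing lane; see the module docstring). [formal bookkeeping] -/
theorem three_mul_P4 (hb : 0 < b) : 3 * P4 b = ∑' n : D3, coef b n * b ^ 4 * s4 n.1 := by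
  have h0 : Tm b 0 0 0 0 = P4 b := rfl
  rw [show (3 : ℝ) * P4 b = Tm b 0 0 0 0 + Tm b 1 1 1 1 + Tm b 2 2 2 2 by rw [Tm_1111, Tm_2222, h0]; ring]
  unfold Tm
  rw [← (summable_Tm hb 0 0 0 0).tsum_add (summable_Tm hb 1 1 1 1),
    ← ((summable_Tm hb 0 0 0 0).add (summable_Tm hb 1 1 1 1)).tsum_add (summable_Tm hb 2 2 2 2)]
  exact tsum_congr fun n => by unfold s4; ring

/-- `three_mul_P22` (docstring added by the landing lane; see the module docstring). [formal bookkeeping] -/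
theorem three_mul_P22 (hb : 0 < b) : 3 * P22 b = ∑' n : D3, coef b n * b ^ 4 * s22 n.1 := by
  have h0 : Tm b 0 0 1 1 = P22 b := rfl
  rw [show (3 : ℝ) * P22 b = Tm b 0 0 1 1 + Tm b 0 0 2 2 + Tm b 1 1 2 2 by rw [Tm_0022, Tm_1122, h0]; ring]
  unfold Tm
  rw [← (summable_Tm hb 0 0 1 1).tsum_add (summable_Tm hb 0 0 2 2),
    ← ((summable_Tm hb 0 0 1 1).add (summable_Tm hb 0 0 2 2)).tsum_add (summable_Tm hb 1 1 2 2)]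
  exact tsum_congr fun n => by unfold s22; ring

/-- `summable_coef_s4` (docstring added by the landing lane; see the module docstring). [formal bookkeeping] -/
theorem summable_coef_s4 (hb : 0 < b) : Summable fun n : D3 => coef b n * b ^ 4 * s4 n.1 :=
  (((summable_Tm hb 0 0 0 0).add (summable_Tm hb 1 1 1 1)).add (summable_Tm hb 2 2 2 2)).congr
    fun n => by unfold s4; ring

/-- `summable_coef_s22` (docstring added by the landing lane; see the module docstring). [formal bookkeeping] -/
theorem summable_coef_s22 (hb : 0 < b) : Summable fun n : D3 => coef b n * b ^ 4 * s22 n.1 :=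
  (((summable_Tm hb 0 0 1 1).add (summable_Tm hb 0 0 2 2)).add (summable_Tm hb 1 1 2 2)).congr
    fun n => by unfold s22; ring

/-- The DEVIATORIC summand `coef·b⁴·(s₄ − s₂₂)/3` and the SHEAR summand `2·coef·b⁴·s₂₂/3`. -/
def fdev (b : ℝ) (n : D3) : ℝ := coef b n * b ^ 4 * (s4 n.1 - s22 n.1) / 3

/-- `fsh` (docstring added by the landing lane; see the module docstring). [formal bookkeeping] -/
def fsh (b : ℝ) (n : D3) : ℝ := 2 * (coef b n * b ^ 4 * s22 n.1) / 3

/-- `summable_fdev` (docstring added by the landing lane; see the module docstring). [formal bookkeeping] -/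
theorem summable_fdev (hb : 0 < b) : Summable (fdev b) :=
  (((summable_coef_s4 hb).sub (summable_coef_s22 hb)).div_const 3).congr fun n => by unfold fdev; ring

/-- `summable_fsh` (docstring added by the landing lane; see the module docstring). [formal bookkeeping] -/
theorem summable_fsh (hb : 0 < b) : Summable (fsh b) :=
  (((summable_coef_s22 hb).mul_left 2).div_const 3).congr fun n => by unfold fsh; ring

/-- ★ `P₄ − P₂₂ = Σ' fdev`. -/
theorem P4_sub_P22_eq (hb : 0 < b) : P4 b - P22 b = ∑' n : D3, fdev b n := by
  have h : ∑' n : D3, fdev b n = ((∑' n : D3, coef b n * b ^ 4 * s4 n.1) - ∑' n : D3, coef b n * b ^ 4 * s22 n.1) / 3 := by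
    rw [← (summable_coef_s4 hb).tsum_sub (summable_coef_s22 hb), ← tsum_div_const]
    exact tsum_congr fun n => by unfold fdev; ring
  rw [h, ← three_mul_P4 hb, ← three_mul_P22 hb]; ring

/-- ★ `2P₂₂ = Σ' fsh`. -/
theorem two_mul_P22_eq (hb : 0 < b) : 2 * P22 b = ∑' n : D3, fsh b n := by
  have h : ∑' n : D3, fsh b n = 2 * (∑' n : D3, coef b n * b ^ 4 * s22 n.1) / 3 := by
    rw [← tsum_mul_left, ← tsum_div_const]
    rfl
  rw [h, ← three_mul_P22 hb]; ring

end Numerics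

end Fcc

end Summit.AtomisticToContinuum.Crystallization.Theorems.ChargedEnergyGapChartDial

end
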